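/-
Copyright (c) 2026 the pub-hodgecm-mathlib formalisation cell (harness21).  Prover seat hodgecm-mathlib-A-p03 (g24); LEAD F0P3a-plan (g9) WORD T8-41 «(F4)–(F8) PEN 1»,
architect A-p06 (g26) (MAP v3 §2, LAYER B «=» 03:57:57Z), 2026-09-01.  Joins B-p10 (g24)'s story `UnramifiedQuadraticNorm*` as FILE 4.
-/
import Literature.NumberTheory.LocalFields.UnramifiedQuadraticNormFibres
import HarnessLib

/-!
# Norm congruences modulo `𝔪^k` inside `R ⧸ 𝔪^m` in an unramified quadratic extension of complete DVRs — the three counts behind Flicker's Props. 10 and 13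

Topic `NumberTheory/LocalFields`, namespace `Literature.NumberTheory.LocalFields.UnramifiedQuadraticNorm` (FILE 4 of the story: FILE 1 ★ `…FixedPoints`
`|R ⧸ 𝔪^k| = q^{2k}`, `|Fix σ̄_k| = q^k`; FILE 2 ★ `…Fibres` norm fibres `q^{k−1}(q+1)`; FILE 3 ★ `…OrderUnitIndex`).  THEOREMS ONLY: no definition, no named fact,
no instance, no notation, no `sorry`; kernel lane.  Cell `pub/hodgecm-mathlib`, road «D-N7-inert» (MAP v3 (F4)–(F8) LAYER B toolkit; census
`F0/P3a/A-p03/g24/CENSUS-F4-F8-FlickerCongruenceVolumes.A-p03g24.md` §4 (β)(γ)).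

SETTING.  `R` a complete discrete valuation ring with finite residue field `𝓀`, `|𝓀| = q²`; `σ` a ring involution of `R` with `σ a − a ∈ Rˣ` for some `a` (the
unramified quadratic situation `R = 𝒪_w ⊃ R^σ = 𝒪_v`); `σ̄_k` the induced involution of `R ⧸ 𝔪^k`; `φ : R ⧸ 𝔪^m → R ⧸ 𝔪^k` the reduction (`k ≤ m`).
* §1 **`natCard_fixed_fibre_factor`** — over a `σ̄_k`-fixed class `y`, the `σ̄_m`-FIXED classes of `R ⧸ 𝔪^m` reducing to `y` number `q^{m−k}`
  (`Fix_m → Fix_k` is an additive homomorphism, ONTO by σ-fixed lifts ★ `exists_fixed_sub_mem`, so all fibres are cosets of one size `|Fix_m| ∕ |Fix_k| = q^m ∕ q^k`).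
  In Flicker's notation: `#{r′ ∈ R ⧸ π^m R : r′ ≡ r (mod π^k)} = q^{m−k}` for the fixed ring `R = R_E^σ`.
* §2 **`natCard_norm_congr_quotient_pow`** — for `1 ≤ k ≤ m` and a `σ`-fixed unit `r`: `#{x ∈ R ⧸ 𝔪^m : x·σ̄_m x ≡ r (mod 𝔪^k)} = q^{m−k} · q^{m−1}(q+1)`
  (the norm `x σ̄_m x` is `σ̄_m`-fixed, so the set fibres over the `q^{m−k}` fixed classes above `r̄`, each fibre of size `q^{m−1}(q+1)` by ★ `natCard_norm_fibre_quotient_pow`).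
  This is Flicker's «a choice of `λ₁` determines `uū ∈ R^× ∕ (1 + π^{m−ν′}R)`; the volume of one coset … multiplied by `[P_H : P_H ∩ H^K_m]`» (Prop. 10 proof, p. 86,
  last lines): the number of `u ∈ (R_E ⧸ π^m)ˣ` with prescribed norm modulo `π^{m−ν′}`.
* §3 **`existsUnique_eq_one_add_mul_mul_sq`** — the CONTRACTION STEP of Prop. 10 (p. 86: «`Δ ≡ 1 + επ^{2j}Δ²` … so that `Δ` is uniquely determined modulo
  `π^{m−ν′}`», `j ≥ 1`): in any commutative ring, if `p` is nilpotent then `x = 1 + ε p x²` has exactly one solution (existence by iterating `x ↦ 1 + εpx²`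
  from `1` — consecutive differences acquire a factor `p` per step; uniqueness from `(x − y)(1 − εp(x+y)) = 0` with the second factor a unit).
HONEST LABEL: HC_CM is proved only modulo the printed citations until rung 0 closes; this file is elementary finite counting and proves no letter.

## References
* [Flicker1998UnitaryFL] Y. Z. Flicker, *Elementary proof of the fundamental lemma for a unitary group*, Canad. J. Math. 50 (1998), 74–98: Prop. 10 pp. 85–86, Prop. 13 pp. 91–93.
* [Serre1979] J.-P. Serre, *Local Fields*, GTM 67 (1979), Ch. V §2 Prop. 2–3 and Corollary.
-/

set_option autoImplicit false

namespace Literature.NumberTheory.LocalFields.UnramifiedQuadraticNorm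

open Literature.LinearAlgebra.Matrix.HermitianFormsHensel Literature.NumberTheory.GaloisRepresentations IsLocalRing

universe u

variable {R : Type u} [CommRing R] (σ : R →+* R)

/-! ## §1 Fixed classes modulo `𝔪^m` over a fixed class modulo `𝔪^k` -/

section FixedFibre

variable [IsDomain R] [IsDiscreteValuationRing R] [Finite (ResidueField R)] (hσ : ∀ a, σ (σ a) = a) {a : R} (ha : IsUnit (σ a - a))
  {q : ℕ} (hq : Nat.card (ResidueField R) = q ^ 2)

omit [Finite (ResidueField R)] in
/-- The reduction `R ⧸ 𝔪^m → R ⧸ 𝔪^k` intertwines `σ̄_m` and `σ̄_k`. [cite: Serre1979, Ch. V §2 Prop. 2] -/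
theorem factor_quotientMap {k m : ℕ} (hkm : k ≤ m) (x : R ⧸ maximalIdeal R ^ m) :
    Ideal.Quotient.factor (Ideal.pow_le_pow_right hkm) (Ideal.quotientMap (maximalIdeal R ^ m) σ (maximalIdeal_pow_le_comap σ hσ m) x) =
      Ideal.quotientMap (maximalIdeal R ^ k) σ (maximalIdeal_pow_le_comap σ hσ k) (Ideal.Quotient.factor (Ideal.pow_le_pow_right hkm) x) := by
  obtain ⟨x, rfl⟩ := Ideal.Quotient.mk_surjective x
  rw [quotientMap_mk σ hσ m, Ideal.Quotient.factor_mk, Ideal.Quotient.factor_mk, quotientMap_mk σ hσ k]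

include ha hq in
/-- **`#{x ∈ Fix(σ̄_m) : x ≡ y (mod 𝔪^k)} = q^{m−k}`** for every `σ̄_k`-fixed class `y` (`k ≤ m`): the reduction `Fix(σ̄_m) → Fix(σ̄_k)` is onto (σ-fixed lifts) and
all its fibres are translates of the kernel, of size `|Fix_m| ∕ |Fix_k| = q^m ∕ q^k`. [cite: Serre1979, Ch. V §2 Prop. 2–3] [cite: Flicker1998UnitaryFL, Prop. 10 p. 86] -/
theorem natCard_fixed_fibre_factor {k m : ℕ} (hkm : k ≤ m) (y : R ⧸ maximalIdeal R ^ k)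
    (hy : Ideal.quotientMap (maximalIdeal R ^ k) σ (maximalIdeal_pow_le_comap σ hσ k) y = y) :
    Nat.card {x : R ⧸ maximalIdeal R ^ m // Ideal.quotientMap (maximalIdeal R ^ m) σ (maximalIdeal_pow_le_comap σ hσ m) x = x ∧
      Ideal.Quotient.factor (Ideal.pow_le_pow_right hkm) x = y} = q ^ (m - k) := by
  classical
  haveI := CompleteLocalRing.finite_quotient_maximalIdeal_pow (R := R) m
  haveI := CompleteLocalRing.finite_quotient_maximalIdeal_pow (R := R) k
  set σm := Ideal.quotientMap (maximalIdeal R ^ m) σ (maximalIdeal_pow_le_comap σ hσ m) with hσm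
  set σk := Ideal.quotientMap (maximalIdeal R ^ k) σ (maximalIdeal_pow_le_comap σ hσ k) with hσk
  set φ := Ideal.Quotient.factor (S := maximalIdeal R ^ m) (T := maximalIdeal R ^ k) (Ideal.pow_le_pow_right hkm) with hφ
  have hφσ : ∀ x, φ (σm x) = σk (φ x) := fun x => factor_quotientMap σ hσ hkm x
  -- the reduction map on fixed points
  let Fm := {x : R ⧸ maximalIdeal R ^ m // σm x = x}
  let Fk := {y : R ⧸ maximalIdeal R ^ k // σk y = y}
  let f : Fm → Fk := fun x => ⟨φ x.1, by rw [← hφσ, x.2]⟩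
  -- onto, by σ-fixed lifts
  have hsurj : Function.Surjective f := by
    rintro ⟨z, hz⟩
    obtain ⟨r₀, rfl⟩ := Ideal.Quotient.mk_surjective z
    have hmem : σ r₀ - r₀ ∈ maximalIdeal R ^ k := by
      rw [← Ideal.Quotient.eq_zero_iff_mem, map_sub, sub_eq_zero, ← quotientMap_mk σ hσ k]; exact hz
    obtain ⟨r, hr, hrr⟩ := exists_fixed_sub_mem σ hσ ha hmem
    refine ⟨⟨Ideal.Quotient.mk _ r, by rw [hσm, quotientMap_mk σ hσ m, hr]⟩, Subtype.ext ?_⟩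
    show φ (Ideal.Quotient.mk _ r) = Ideal.Quotient.mk _ r₀
    rw [hφ, Ideal.Quotient.factor_mk, Ideal.Quotient.eq]; exact hrr
  -- every fibre is a translate of the fibre over the class of `y`
  haveI : Finite Fm := Subtype.finite
  haveI : Finite Fk := Subtype.finite
  letI : Fintype Fk := Fintype.ofFinite Fk
  have hfib : ∀ z z' : Fk, Nat.card {x : Fm // f x = z} = Nat.card {x : Fm // f x = z'} := by
    intro z z'
    obtain ⟨x₀, hx₀⟩ := hsurj z
    obtain ⟨x₁, hx₁⟩ := hsurj z'
    refine Nat.card_congr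
      { toFun := fun x => ⟨⟨x.1.1 - x₀.1 + x₁.1, by rw [map_add, map_sub, x.1.2, x₀.2, x₁.2]⟩, ?_⟩
        invFun := fun x => ⟨⟨x.1.1 - x₁.1 + x₀.1, by rw [map_add, map_sub, x.1.2, x₀.2, x₁.2]⟩, ?_⟩
        left_inv := fun x => by ext; simp
        right_inv := fun x => by ext; simp }
    · apply Subtype.ext
      have h1 := congrArg Subtype.val x.2; have h0 := congrArg Subtype.val hx₀; have h1' := congrArg Subtype.val hx₁
      simp only [f] at h1 h0 h1' ⊢
      rw [map_add, map_sub, h1, h0, h1', sub_self, zero_add]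
    · apply Subtype.ext
      have h1 := congrArg Subtype.val x.2; have h0 := congrArg Subtype.val hx₀; have h1' := congrArg Subtype.val hx₁
      simp only [f] at h1 h0 h1' ⊢
      rw [map_add, map_sub, h1, h0, h1', sub_self, zero_add]
  -- |Fm| = |Fk| · (fibre size)
  have hFm : Nat.card Fm = q ^ m := natCard_fixed_quotient_pow σ hσ ha hq m
  have hFk : Nat.card Fk = q ^ k := natCard_fixed_quotient_pow σ hσ ha hq k
  have hsum : Nat.card Fm = ∑ z : Fk, Nat.card {x : Fm // f x = z} := by
    rw [← Nat.card_sigma]; exact Nat.card_congr (Equiv.sigmaFiberEquiv f).symm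
  have hconst : ∑ z : Fk, Nat.card {x : Fm // f x = z} = Nat.card Fk * Nat.card {x : Fm // f x = ⟨y, hy⟩} := by
    rw [Finset.sum_congr rfl fun z _ => hfib z ⟨y, hy⟩, Finset.sum_const, smul_eq_mul, Finset.card_univ, ← Nat.card_eq_fintype_card]
  have hq0 : 0 < q := by
    rcases Nat.eq_zero_or_pos q with h0 | h0
    · exfalso
      have h1 : 0 < Nat.card (ResidueField R) := Nat.card_pos
      rw [hq, h0] at h1; simp at h1
    · exact h0
  have hcard : Nat.card {x : Fm // f x = ⟨y, hy⟩} = q ^ (m - k) := by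
    have h := hsum; rw [hconst, hFm, hFk] at h
    have hsplit : q ^ m = q ^ k * q ^ (m - k) := by rw [← pow_add, Nat.add_sub_cancel' hkm]
    rw [hsplit] at h
    exact (Nat.eq_of_mul_eq_mul_left (pow_pos hq0 k) h).symm
  rw [← hcard]
  -- the two subtypes agree
  refine Nat.card_congr
    { toFun := fun x => ⟨⟨x.1, x.2.1⟩, Subtype.ext x.2.2⟩
      invFun := fun x => ⟨x.1.1, x.1.2, congrArg Subtype.val x.2⟩
      left_inv := fun x => rfl
      right_inv := fun x => rfl }

end FixedFibre

/-! ## §2 Norms prescribed modulo `𝔪^k` -/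

section NormCongruence

variable [IsDomain R] [IsDiscreteValuationRing R] [Finite (ResidueField R)] [IsAdicComplete (maximalIdeal R) R]
  (hσ : ∀ a, σ (σ a) = a) {a : R} (ha : IsUnit (σ a - a)) {q : ℕ} (hq : Nat.card (ResidueField R) = q ^ 2)

include ha hq in
/-- **`#{x ∈ R ⧸ 𝔪^m : x · σ̄_m x ≡ r (mod 𝔪^k)} = q^{m−k} · q^{m−1}(q+1)`** for `1 ≤ k ≤ m` and a `σ`-fixed unit `r` (Flicker: the number of `u ∈ (R_E ⧸ π^m)ˣ` whose
norm `uū` lies in a prescribed class of `R^× ∕ (1 + π^k R)`).  The norm is `σ̄_m`-fixed, so the set is fibred over the `q^{m−k}` fixed classes above `r̄` (§1), each fibre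
of size `q^{m−1}(q+1)` (★ `natCard_norm_fibre_quotient_pow`, after a σ-fixed unit lift of the class). [cite: Flicker1998UnitaryFL, Prop. 10 p. 86; Prop. 13 p. 92]
[cite: Serre1979, Ch. V §2 Prop. 3 and Corollary] -/
theorem natCard_norm_congr_quotient_pow {k m : ℕ} (hk : 1 ≤ k) (hkm : k ≤ m) {r : R} (hr : IsUnit r) (hσr : σ r = r) :
    Nat.card {x : R ⧸ maximalIdeal R ^ m //
      Ideal.Quotient.factor (Ideal.pow_le_pow_right hkm) (x * Ideal.quotientMap (maximalIdeal R ^ m) σ (maximalIdeal_pow_le_comap σ hσ m) x) =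
        Ideal.Quotient.mk (maximalIdeal R ^ k) r} = q ^ (m - k) * (q ^ (m - 1) * (q + 1)) := by
  classical
  haveI := CompleteLocalRing.finite_quotient_maximalIdeal_pow (R := R) m
  haveI := CompleteLocalRing.finite_quotient_maximalIdeal_pow (R := R) k
  set σm := Ideal.quotientMap (maximalIdeal R ^ m) σ (maximalIdeal_pow_le_comap σ hσ m) with hσm
  set σk := Ideal.quotientMap (maximalIdeal R ^ k) σ (maximalIdeal_pow_le_comap σ hσ k) with hσk
  set φ := Ideal.Quotient.factor (S := maximalIdeal R ^ m) (T := maximalIdeal R ^ k) (Ideal.pow_le_pow_right hkm) with hφ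
  have hσmσm : ∀ x, σm (σm x) = x := quotientMap_quotientMap σ hσ m
  let N : R ⧸ maximalIdeal R ^ m → R ⧸ maximalIdeal R ^ m := fun x => x * σm x
  have hNfix : ∀ x, σm (N x) = N x := fun x => by simp only [N, map_mul, hσmσm, mul_comm]
  -- fibre the set over the fixed classes above `r̄`
  let Q : R ⧸ maximalIdeal R ^ m → Prop := fun y => σm y = y ∧ φ y = Ideal.Quotient.mk (maximalIdeal R ^ k) r
  have hPQ : ∀ x, φ (N x) = Ideal.Quotient.mk (maximalIdeal R ^ k) r ↔ Q (N x) := fun x => ⟨fun h => ⟨hNfix x, h⟩, fun h => h.2⟩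
  haveI : Finite (Subtype Q) := Subtype.finite
  letI : Fintype (Subtype Q) := Fintype.ofFinite _
  rw [← Nat.card_congr (Equiv.sigmaSubtypeFiberEquivSubtype N hPQ), Nat.card_sigma]
  -- each fibre has q^(m-1)(q+1) elements
  have hfibre : ∀ y : Subtype Q, Nat.card {x : R ⧸ maximalIdeal R ^ m // N x = y} = q ^ (m - 1) * (q + 1) := by
    rintro ⟨y, hyfix, hyr⟩
    obtain ⟨r₀, rfl⟩ := Ideal.Quotient.mk_surjective y
    have hmem : σ r₀ - r₀ ∈ maximalIdeal R ^ m := by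
      rw [← Ideal.Quotient.eq_zero_iff_mem, map_sub, sub_eq_zero, ← quotientMap_mk σ hσ m]; exact hyfix
    obtain ⟨r', hr', hrr'⟩ := exists_fixed_sub_mem σ hσ ha hmem
    have hy' : Ideal.Quotient.mk (maximalIdeal R ^ m) r₀ = Ideal.Quotient.mk (maximalIdeal R ^ m) r' := by
      rw [Ideal.Quotient.eq, ← neg_sub]; exact (Ideal.neg_mem_iff _).2 hrr'
    -- `r'` is a unit: it agrees with the unit `r` modulo `𝔪^k ⊆ 𝔪`
    have hr'unit : IsUnit r' := by
      have hk' : Ideal.Quotient.mk (maximalIdeal R ^ k) r' = Ideal.Quotient.mk (maximalIdeal R ^ k) r := by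
        rw [← hyr, hy', hφ, Ideal.Quotient.factor_mk]
      rw [Ideal.Quotient.eq] at hk'
      have hsub : r' - r ∈ maximalIdeal R := Ideal.pow_le_self (by omega) hk'
      by_contra hnu
      have hr'm : r' ∈ maximalIdeal R := (mem_maximalIdeal _).2 hnu
      have hrm : r ∈ maximalIdeal R := by
        have := Ideal.sub_mem _ hr'm hsub; rwa [sub_sub_cancel] at this
      exact (mem_maximalIdeal _).1 hrm hr
    have hm1 : 1 ≤ m := le_trans hk hkm
    have h := natCard_norm_fibre_quotient_pow σ hσ ha hq hm1 hr'unit hr'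
    rw [← h]
    refine Nat.card_congr (Equiv.subtypeEquivRight fun x => ?_)
    show N x = Ideal.Quotient.mk (maximalIdeal R ^ m) r₀ ↔ _
    rw [hy']
  rw [Finset.sum_congr rfl fun y _ => hfibre y, Finset.sum_const, smul_eq_mul, Finset.card_univ, ← Nat.card_eq_fintype_card]
  congr 1
  have hrk : σk (Ideal.Quotient.mk (maximalIdeal R ^ k) r) = Ideal.Quotient.mk (maximalIdeal R ^ k) r := by rw [hσk, quotientMap_mk σ hσ k, hσr]
  exact natCard_fixed_fibre_factor σ hσ ha hq hkm _ hrk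

end NormCongruence

/-! ## §3 The contraction step -/

/-- **Contraction step** (Flicker p. 86: «`Δ ≡ 1 + επ^{2j}Δ²`, so that `Δ` is uniquely determined modulo `π^{m−ν′}`», `j ≥ 1`): in a commutative ring, if `p` is
nilpotent then `x = 1 + ε·p·x²` has EXACTLY ONE solution.  Existence: iterate `F(x) = 1 + εpx²` from `1` — consecutive differences gain a factor `p` each step;
uniqueness: two solutions differ by `(x − y)(1 − εp(x + y)) = 0` with the second factor a unit. [cite: Flicker1998UnitaryFL, Prop. 10 p. 86] -/
theorem existsUnique_eq_one_add_mul_mul_sq {A : Type*} [CommRing A] {p : A} (hp : IsNilpotent p) (ε : A) :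
    ∃! x : A, x = 1 + ε * p * x ^ 2 := by
  set F : A → A := fun x => 1 + ε * p * x ^ 2 with hF
  -- consecutive iterates differ by a multiple of p^(k+1)
  have hdiff : ∀ k : ℕ, ∃ e : A, F^[k + 1] 1 - F^[k] 1 = p ^ (k + 1) * e := by
    intro k
    induction k with
    | zero => exact ⟨ε, by simp [hF]; ring⟩
    | succ k ih =>
      obtain ⟨e, he⟩ := ih
      refine ⟨ε * e * (F^[k + 1] 1 + F^[k] 1), ?_⟩
      have h1 : F^[k + 2] 1 = F (F^[k + 1] 1) := Function.iterate_succ_apply' F (k + 1) 1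
      have h2 : F^[k + 1] 1 = F (F^[k] 1) := Function.iterate_succ_apply' F k 1
      rw [h1, h2]
      have h3 : F (F^[k] 1) - F^[k] 1 = p ^ (k + 1) * e := by rw [← h2]; exact he
      simp only [hF] at h3 ⊢
      have : (1 + ε * p * (1 + ε * p * (F^[k] 1) ^ 2) ^ 2) - (1 + ε * p * (F^[k] 1) ^ 2)
          = ε * p * (((1 + ε * p * (F^[k] 1) ^ 2) - F^[k] 1) * ((1 + ε * p * (F^[k] 1) ^ 2) + F^[k] 1)) := by ring
      rw [this, h3]; ring
  obtain ⟨n, hn⟩ := hp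
  have hfix : F (F^[n] 1) = F^[n] 1 := by
    obtain ⟨e, he⟩ := hdiff n
    have h1 : F^[n + 1] 1 = F (F^[n] 1) := Function.iterate_succ_apply' F n 1
    have hzero : F^[n + 1] 1 - F^[n] 1 = 0 := by rw [he, pow_succ, hn, zero_mul, zero_mul]
    rw [← h1]; exact sub_eq_zero.mp hzero
  refine ⟨F^[n] 1, hfix.symm, ?_⟩
  intro y hy
  set x := F^[n] 1 with hx
  have hxF : x = 1 + ε * p * x ^ 2 := hfix.symm
  have hprod : (y - x) * (1 - ε * p * (y + x)) = 0 := by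
    have : y - x = ε * p * (y + x) * (y - x) := by
      conv_lhs => rw [hy, hxF]
      ring
    linear_combination this
  have hu : IsUnit (1 - ε * p * (y + x)) := by
    refine IsNilpotent.isUnit_one_sub ?_
    exact Commute.isNilpotent_mul_right (Commute.all _ _) (Commute.isNilpotent_mul_left (Commute.all _ _) ⟨n, hn⟩)
  exact sub_eq_zero.mp (hu.mul_left_eq_zero.mp hprod)

end Literature.NumberTheory.LocalFields.UnramifiedQuadraticNorm
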